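import Summits.QuantumFields.BalabanUV.Beta.FP.FarRegionBubble
import Summits.QuantumFields.BalabanUV.Beta.FP.FarRegionSmearGraded

/-!
# `BalabanUV.Beta.FP.FarRegionBubbleGraded` — road «FP» (binder row D1), `RHOA-DESIGN.md` §5 row RHOA-4 (b) «bubble-level», FILE E: GRADED LEGS ⟹ THE FAR SHAPE
# OF THE BRACKET BUBBLE — the far bound of `FP/FarRegionBubble` fed with the scale-`n` graded leg data, in the shape `Ψ_m(s) = e^{−(m/n)s}(1+s/n)²/s^{2a+2}`, the
# trivial core, and the UNIFORM far shape beyond the window = the `hfar` of `FP/FarRegionMoment` with `(C, δ, b) := (Kb + Kc, m, 2)` (exponent `2a+2`, = 6 for degree-2 legs)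
# ([folklore] real analysis on `ℤ⁴`; G-an2-4 formalisation swarm, unit `b2b-balaban-gan24-formalise-leaf-06`, gen 32, cross-lane idle-seat brick)
HONEST DEPENDENCY (page 1, mandatory): continuum YM on T⁴ ⇐ BetaPertH ∧ nine spine estimates (0/9 proved); BetaPertH ⇐ (D1) ∧ (D4) ∧
CAP+tail; G-an2-4 gates asym, D1 and NE2/3/4.  HONEST FRAMING (cell contract, verbatim): «discharging `BetaPertH` makes Bałaban's UV
stability UNCONDITIONAL — a real constructive-QFT result; it is NOT the continuum limit and NOT the Clay problem.»  THIS MODULE is [folklore] real analysis over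
gen-32's `FarRegionBubble.abs_bracket_le_far`, `FarRegionSmearGraded.outer0_of_graded ∕ termBc_le` and leaf-02-g6's letters; no `def`, no cite, no `Prop` fact, 0 sorry;
the GRADED leg data and the weights' localisation are HYPOTHESES (suppliers: IR-5∕IR-6, H2V — OPEN).  NOT `hbook`, NOT `ρ_n`, NOT D1, NOT BetaPertH, NOT continuum, NOT Clay.
CONTENT (`s := ‖z‖∞`, `ρ := ⌊s/4⌋`, `κF := 4A₁(4/3)^{a+1}(5/4) + 16·2^a·A₀`, `θ_m` the letters at rate `δ/2`, `Θ₀(δ)` at rate `δ`): §1 `box1_of_graded`, `legFactor_le`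
(`αF ≤ κF·e^{−(η/2/n)s}(1+s/n)/s^{a+1}`); §2 **`abs_bracket_le_of_graded_far`** (`‖z‖∞ ≥ 8`, `0 < m ≤ min(η, δ/8)`): `|Σ' bracket| ≤ Kb·Ψ_m(s)`,
`Kb := CV·CW·(16κFκG·θ₂θ₀ + e^{δ/4}((2a+2)!(8/δ)^{2a+2})(8(κF·Gg + κG·Fg)θ₁θ₀ + 4FgGg·θ₀²))`; §3 `abs_bracket_le_trivial`, **`abs_bracket_le_of_graded`**: for EVERY
`‖z‖∞ > n ≥ 1`, `|Σ' bracket| ≤ (Kb + Kc)/s^{2a+2}·(e^{−(m/n)s}(1+s/n)²)`, `Kc := CV·CW·4FgGg·Θ₀(δ)²·8^{2a+2}e^{8m}`.  Sequel: `FP/FarRegionBubbleMoment` (chain at `a = 2`,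
identity «bubble = bracket»).  Provenance: leaf prover 06 (gen 32), 2026-08-21; «not in print; our bookkeeping»; no existing file touched.
-/

noncomputable section

namespace Summit.QuantumFields.BalabanUV.Beta.FP.FarRegionBubbleGraded

open Finset Filter Topology fwdDiff
open scoped BigOperators
open Literature.MathematicalPhysics.QuantumFieldTheory.Balaban1983to89
open Literature.MathematicalPhysics.QuantumFieldTheory.Balaban1983to89.Beta
open B12Sec2to5 (l1 l1_nonneg abs_coord_le_l1)
open ExpKernelCalculus (Site Zl Zl_pos l1_sub_triangle l1_sub_symm)
open DyadicShell (Pt supNorm)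
open Summit.QuantumFields.BalabanUV.Beta.FP.HorizontalBookkeepingTail (supNorm_le_add_of_box)
open Summit.QuantumFields.BalabanUV.Beta.FP.ExpLocalisedBubble
open Summit.QuantumFields.BalabanUV.Beta.FP.FarRegionSmear
open Summit.QuantumFields.BalabanUV.Beta.FP.FarRegionSmearGraded
open Summit.QuantumFields.BalabanUV.Beta.FP.FarRegionBubble

/-! ## §1 Graded legs: the outer first-difference constant and the leg factor `αF ≤ κF·Φ₁` -/

section GradedLegs

variable {V W : Pt × Pt → ℝ} {F G : Pt → ℝ} {CV CW δ Fg Gg A₀ A₁ B₀ B₁ η m : ℝ} {n a : ℕ} {z : Pt}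

/-- [folklore] BOX FIRST DIFFERENCES from the graded order-1 datum (`‖z‖∞ ≥ 8`, box radius `⌊‖z‖∞/4⌋`):
`|F(t+eᵢ) − F t| ≤ A₁·(4/(3‖z‖∞))^{a+1}·e^{−(η/2/n)‖z‖∞}·((5/4)(1+‖z‖∞/n))`. -/
theorem box1_of_graded (hA1 : 0 ≤ A₁) (hη : 0 < η) (hn : 1 ≤ n)
    (hG1 : ∀ t : Pt, 0 < supNorm t → ∀ i, |Δ_[(Pi.single i 1 : Pt)] F t|
      ≤ A₁ / (supNorm t : ℝ) ^ (a + 1) * (Real.exp (-(η / n) * supNorm t) * (1 + (supNorm t : ℝ) / n)))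
    (hz : 8 ≤ supNorm z) (t : Pt) (ht : ∀ i, |t i - z i| ≤ ((supNorm z / 4 : ℕ) : ℤ)) (i : Fin 4) :
    |F (t + Pi.single i 1) - F t|
      ≤ A₁ * (4 / (3 * (supNorm z : ℝ))) ^ (a + 1) * (Real.exp (-(η / 2 / n) * supNorm z) * ((5 / 4 : ℝ) * (1 + (supNorm z : ℝ) / n))) := by
  have hlo := supNorm_le_add_of_box ht
  have hhi := supNorm_le_add_of_box (t := z) (y := t) (ρ := supNorm z / 4) fun k => by rw [abs_sub_comm]; exact ht k
  have hu34 : 3 * (supNorm z : ℝ) ≤ 4 * (supNorm t : ℝ) := by exact_mod_cast (show 3 * supNorm z ≤ 4 * supNorm t by omega)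
  have hu54 : 4 * (supNorm t : ℝ) ≤ 5 * (supNorm z : ℝ) := by exact_mod_cast (show 4 * supNorm t ≤ 5 * supNorm z by omega)
  have hupos : 0 < supNorm t := by omega
  have hu0 : (0 : ℝ) < supNorm t := by exact_mod_cast hupos
  have hs0 : (0 : ℝ) < supNorm z := by exact_mod_cast (show 0 < supNorm z by omega)
  have hn' : (0 : ℝ) < n := by exact_mod_cast hn
  have h := hG1 t hupos i
  simp only [fwdDiff] at h
  refine h.trans ?_
  have h1 : A₁ / (supNorm t : ℝ) ^ (a + 1) ≤ A₁ * (4 / (3 * (supNorm z : ℝ))) ^ (a + 1) := by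
    rw [div_eq_mul_inv, ← inv_pow]
    refine mul_le_mul_of_nonneg_left (pow_le_pow_left₀ (by positivity) ?_ (a + 1)) hA1
    rw [inv_eq_one_div, div_le_div_iff₀ hu0 (by positivity)]; linarith
  have h2 : Real.exp (-(η / n) * supNorm t) ≤ Real.exp (-(η / 2 / n) * supNorm z) := by
    refine Real.exp_le_exp.mpr ?_
    have : η / 2 / n * (supNorm z : ℝ) ≤ η / n * (supNorm t : ℝ) := by
      rw [show η / 2 / (n : ℝ) * (supNorm z : ℝ) = η / n * ((supNorm z : ℝ) / 2) by ring]
      exact mul_le_mul_of_nonneg_left (by linarith) (div_nonneg hη.le hn'.le)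
    linarith
  have h3 : (1 + (supNorm t : ℝ) / n) ≤ (5 / 4 : ℝ) * (1 + (supNorm z : ℝ) / n) := by
    have h4 : (supNorm t : ℝ) / n ≤ (5 / 4) * ((supNorm z : ℝ) / n) := by
      rw [show (5 / 4 : ℝ) * ((supNorm z : ℝ) / n) = (5 * (supNorm z : ℝ) / 4) / n by ring]
      exact div_le_div_of_nonneg_right (by linarith) hn'.le
    have h5 : 0 ≤ (supNorm z : ℝ) / n := div_nonneg hs0.le hn'.le
    linarith
  exact mul_le_mul h1 (mul_le_mul h2 h3 (by positivity) (Real.exp_pos _).le) (by positivity) (by positivity)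

/-- [folklore] THE LEG FACTOR: with the outer sup `A₀(2/s)^a e^{−(η/2/n)s}` and the box first differences of `box1_of_graded`,
`αF := 4b + 2a₀/ρ ≤ κ·(e^{−(η/2/n)s}(1+s/n)/s^{a+1})`, `κ := 4A₁(4/3)^{a+1}(5/4) + 16·2^a·A₀` (`s ≤ 8ρ`, `1 ≤ n`). -/
theorem legFactor_le {s ρ : ℝ} (hs : 0 < s) (hρ : s ≤ 8 * ρ) (hA0 : 0 ≤ A₀) (hn : (0 : ℝ) < n) :
    4 * (A₁ * (4 / (3 * s)) ^ (a + 1) * (Real.exp (-(η / 2 / n) * s) * ((5 / 4 : ℝ) * (1 + s / n))))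
        + 2 * (A₀ * (2 / s) ^ a * Real.exp (-(η / 2 / n) * s)) / ρ
      ≤ (4 * A₁ * (4 / 3 : ℝ) ^ (a + 1) * (5 / 4) + 16 * 2 ^ a * A₀) * (Real.exp (-(η / 2 / n) * s) * (1 + s / n) / s ^ (a + 1)) := by
  have hρ0 : 0 < ρ := by linarith
  have e1 : 4 * (A₁ * (4 / (3 * s)) ^ (a + 1) * (Real.exp (-(η / 2 / n) * s) * ((5 / 4 : ℝ) * (1 + s / n))))
      = (4 * A₁ * (4 / 3 : ℝ) ^ (a + 1) * (5 / 4)) * (Real.exp (-(η / 2 / n) * s) * (1 + s / n) / s ^ (a + 1)) := by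
    rw [show (4 / (3 * s) : ℝ) = (4 / 3) / s by field_simp, div_pow]; ring
  have hinv : 1 / ρ ≤ 8 / s := by rw [div_le_div_iff₀ hρ0 hs]; linarith
  have hu : 1 ≤ 1 + s / n := le_add_of_nonneg_right (div_nonneg hs.le hn.le)
  have e2 : 2 * (A₀ * (2 / s) ^ a * Real.exp (-(η / 2 / n) * s)) / ρ = 2 * A₀ * 2 ^ a * Real.exp (-(η / 2 / n) * s) / s ^ a * (1 / ρ) := by
    rw [div_pow]; ring
  have h2 : 2 * (A₀ * (2 / s) ^ a * Real.exp (-(η / 2 / n) * s)) / ρ ≤ (16 * 2 ^ a * A₀) * (Real.exp (-(η / 2 / n) * s) * (1 + s / n) / s ^ (a + 1)) := by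
    rw [e2]
    calc 2 * A₀ * 2 ^ a * Real.exp (-(η / 2 / n) * s) / s ^ a * (1 / ρ)
        ≤ 2 * A₀ * 2 ^ a * Real.exp (-(η / 2 / n) * s) / s ^ a * (8 / s) := mul_le_mul_of_nonneg_left hinv (by positivity)
      _ = (16 * 2 ^ a * A₀) * (Real.exp (-(η / 2 / n) * s) * 1 / s ^ (a + 1)) := by rw [pow_succ]; field_simp; ring
      _ ≤ (16 * 2 ^ a * A₀) * (Real.exp (-(η / 2 / n) * s) * (1 + s / n) / s ^ (a + 1)) := by
          refine mul_le_mul_of_nonneg_left (div_le_div_of_nonneg_right ?_ (by positivity)) (by positivity)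
          exact mul_le_mul_of_nonneg_left hu (Real.exp_pos _).le
  rw [e1, add_mul]
  linarith

end GradedLegs

/-! ## §2 The bracket double smear of GRADED legs at a far point: the shape `Ψ_m(s) = e^{−(m/n)s}(1+s/n)²/s^{2a+2}` -/

section GradedFar

variable {V W : Pt × Pt → ℝ} {F G : Pt → ℝ} {CV CW δ Fg Gg A₀ A₁ B₀ B₁ η m : ℝ} {n a : ℕ}

/-- [folklore] **GRADED LEGS ⟹ THE FAR SHAPE OF THE BRACKET DOUBLE SMEAR** (`‖z‖∞ ≥ 8`).  Weights as in `abs_bracket_le_far`; legs `|F| ≤ Fg`, `|G| ≤ Gg` with the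
scale-`n` GRADED data `|F t| ≤ A₀‖t‖∞^{−a}e^{−(η/n)‖t‖∞}`, `|Δ_iF t| ≤ A₁‖t‖∞^{−a−1}e^{−(η/n)‖t‖∞}(1+‖t‖∞/n)` (`t ≠ 0`), the same for `G` with `B₀, B₁`;
rate `0 < m ≤ min(η, δ/8)` ⟹ with `κF := 4A₁(4/3)^{a+1}(5/4) + 16·2^a·A₀`, `κG` likewise, `θ_m` the letters at rate `δ/2`, `s := ‖z‖∞`:
`|Σ' V·W·(ΔF-bracket)·(ΔG-bracket)| ≤ CV·CW·(16κFκG·θ₂θ₀ + e^{δ/4}((2a+2)!(8/δ)^{2a+2})·(8(κF·Gg + κG·Fg)θ₁θ₀ + 4FgGg·θ₀²))·Ψ_m(s)`. -/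
theorem abs_bracket_le_of_graded_far (hδ : 0 < δ)
    (hV : ∀ p : Pt × Pt, |V p| ≤ CV * (Real.exp (-δ * l1 p.1) * Real.exp (-δ * l1 p.2)))
    (hW : ∀ q : Pt × Pt, |W q| ≤ CW * (Real.exp (-δ * l1 q.1) * Real.exp (-δ * l1 q.2)))
    (hFg : ∀ t, |F t| ≤ Fg) (hGg : ∀ t, |G t| ≤ Gg) (hn : 1 ≤ n) (hη : 0 < η)
    (hA0 : 0 ≤ A₀) (hA1 : 0 ≤ A₁) (hB0 : 0 ≤ B₀) (hB1 : 0 ≤ B₁)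
    (hF0g : ∀ t : Pt, 0 < supNorm t → |F t| ≤ A₀ / (supNorm t : ℝ) ^ a * Real.exp (-(η / n) * supNorm t))
    (hF1g : ∀ t : Pt, 0 < supNorm t → ∀ i, |Δ_[(Pi.single i 1 : Pt)] F t|
      ≤ A₁ / (supNorm t : ℝ) ^ (a + 1) * (Real.exp (-(η / n) * supNorm t) * (1 + (supNorm t : ℝ) / n)))
    (hG0g : ∀ t : Pt, 0 < supNorm t → |G t| ≤ B₀ / (supNorm t : ℝ) ^ a * Real.exp (-(η / n) * supNorm t))
    (hG1g : ∀ t : Pt, 0 < supNorm t → ∀ i, |Δ_[(Pi.single i 1 : Pt)] G t|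
      ≤ B₁ / (supNorm t : ℝ) ^ (a + 1) * (Real.exp (-(η / n) * supNorm t) * (1 + (supNorm t : ℝ) / n)))
    (hm : 0 < m) (hmη : m ≤ η) (hmδ : m ≤ δ / 8) {z : Pt} (hz : 8 ≤ supNorm z) :
    |∑' P : (Pt × Pt) × (Pt × Pt),
        V P.1 * W P.2 * ((F (z + (P.2.2 - P.1.1)) - F (z + (P.2.2 - P.1.2))) * (G (z + (P.2.1 - P.1.2)) - G (z + (P.2.2 - P.1.2))))|
      ≤ CV * CW * (16 * (4 * A₁ * (4 / 3 : ℝ) ^ (a + 1) * (5 / 4) + 16 * 2 ^ a * A₀) * (4 * B₁ * (4 / 3 : ℝ) ^ (a + 1) * (5 / 4) + 16 * 2 ^ a * B₀)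
              * (2 ^ (2 + 1) * (((2 : ℕ).factorial : ℝ) * Real.exp (δ / 2 / 2) * (2 / (δ / 2)) ^ 2) * Real.exp (δ / 2 / 2) * Zl 4 (δ / 2 / 2) ^ 2)
              * (2 ^ (0 + 1) * (((0 : ℕ).factorial : ℝ) * Real.exp (δ / 2 / 2) * (2 / (δ / 2)) ^ 0) * Real.exp (δ / 2 / 2) * Zl 4 (δ / 2 / 2) ^ 2)
            + Real.exp (δ / 4) * (((2 * a + 2).factorial : ℝ) * (8 / δ) ^ (2 * a + 2))
              * (8 * ((4 * A₁ * (4 / 3 : ℝ) ^ (a + 1) * (5 / 4) + 16 * 2 ^ a * A₀) * Gg + (4 * B₁ * (4 / 3 : ℝ) ^ (a + 1) * (5 / 4) + 16 * 2 ^ a * B₀) * Fg)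
                  * (2 ^ (1 + 1) * (((1 : ℕ).factorial : ℝ) * Real.exp (δ / 2 / 2) * (2 / (δ / 2)) ^ 1) * Real.exp (δ / 2 / 2) * Zl 4 (δ / 2 / 2) ^ 2)
                  * (2 ^ (0 + 1) * (((0 : ℕ).factorial : ℝ) * Real.exp (δ / 2 / 2) * (2 / (δ / 2)) ^ 0) * Real.exp (δ / 2 / 2) * Zl 4 (δ / 2 / 2) ^ 2)
                + 4 * Fg * Gg
                  * (2 ^ (0 + 1) * (((0 : ℕ).factorial : ℝ) * Real.exp (δ / 2 / 2) * (2 / (δ / 2)) ^ 0) * Real.exp (δ / 2 / 2) * Zl 4 (δ / 2 / 2) ^ 2) ^ 2))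
        * (Real.exp (-(m / n) * supNorm z) * (1 + (supNorm z : ℝ) / n) ^ 2 / (supNorm z : ℝ) ^ (2 * a + 2)) := by
  have hCV : 0 ≤ CV := nonneg_of_loc hV
  have hCW : 0 ≤ CW := nonneg_of_loc hW
  have hFg0 : 0 ≤ Fg := (abs_nonneg _).trans (hFg z)
  have hGg0 : 0 ≤ Gg := (abs_nonneg _).trans (hGg z)
  have hZ : 0 < Zl 4 (δ / 2 / 2) := Zl_pos (by positivity)
  have hn' : (0 : ℝ) < n := by exact_mod_cast hn
  have hs8 : (8 : ℝ) ≤ (supNorm z : ℝ) := by exact_mod_cast hz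
  have hs0 : (0 : ℝ) < (supNorm z : ℝ) := by linarith
  have hρ8 : (supNorm z : ℝ) ≤ 8 * (((supNorm z / 4 : ℕ) : ℕ) : ℝ) := by
    exact_mod_cast (show supNorm z ≤ 8 * (supNorm z / 4) by omega)
  obtain ⟨-, hfar⟩ := abs_bracket_le_far hδ hV hW hFg hGg hz (by positivity) (by positivity)
    (outer0_of_graded hA0 hη hF0g (by omega)) (box1_of_graded hA1 hη hn hF1g hz)
    (outer0_of_graded hB0 hη hG0g (by omega)) (box1_of_graded hB1 hη hn hG1g hz)
  refine hfar.trans ?_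
  set s : ℝ := (supNorm z : ℝ) with hs
  have hαF := legFactor_le (A₁ := A₁) (A₀ := A₀) (a := a) (η := η) hs0 hρ8 hA0 hn'
  have hαG := legFactor_le (A₁ := B₁) (A₀ := B₀) (a := a) (η := η) hs0 hρ8 hB0 hn'
  set θ0 : ℝ := 2 ^ (0 + 1) * (((0 : ℕ).factorial : ℝ) * Real.exp (δ / 2 / 2) * (2 / (δ / 2)) ^ 0) * Real.exp (δ / 2 / 2) * Zl 4 (δ / 2 / 2) ^ 2 with hθ0
  set θ1 : ℝ := 2 ^ (1 + 1) * (((1 : ℕ).factorial : ℝ) * Real.exp (δ / 2 / 2) * (2 / (δ / 2)) ^ 1) * Real.exp (δ / 2 / 2) * Zl 4 (δ / 2 / 2) ^ 2 with hθ1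
  set θ2 : ℝ := 2 ^ (2 + 1) * (((2 : ℕ).factorial : ℝ) * Real.exp (δ / 2 / 2) * (2 / (δ / 2)) ^ 2) * Real.exp (δ / 2 / 2) * Zl 4 (δ / 2 / 2) ^ 2 with hθ2
  have hθ0p : 0 ≤ θ0 := by positivity
  have hθ1p : 0 ≤ θ1 := by positivity
  have hθ2p : 0 ≤ θ2 := by positivity
  set κF : ℝ := 4 * A₁ * (4 / 3 : ℝ) ^ (a + 1) * (5 / 4) + 16 * 2 ^ a * A₀ with hκF
  set κG : ℝ := 4 * B₁ * (4 / 3 : ℝ) ^ (a + 1) * (5 / 4) + 16 * 2 ^ a * B₀ with hκG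
  have hκF0 : 0 ≤ κF := by positivity
  have hκG0 : 0 ≤ κG := by positivity
  set Φ : ℝ := Real.exp (-(η / 2 / n) * s) * (1 + s / n) / s ^ (a + 1) with hΦ
  have hΦ0 : 0 ≤ Φ := by positivity
  set u : ℝ := 1 + s / n with hu
  have hu1 : 1 ≤ u := le_add_of_nonneg_right (div_nonneg hs0.le hn'.le)
  set Ψ : ℝ := Real.exp (-(m / n) * s) * u ^ 2 / s ^ (2 * a + 2) with hΨ
  have hΨ0 : 0 ≤ Ψ := by positivity
  set αF : ℝ := 4 * (A₁ * (4 / (3 * s)) ^ (a + 1) * (Real.exp (-(η / 2 / n) * s) * ((5 / 4 : ℝ) * u)))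
      + 2 * (A₀ * (2 / s) ^ a * Real.exp (-(η / 2 / n) * s)) / (((supNorm z / 4 : ℕ) : ℕ) : ℝ) with hαFdef
  set αG : ℝ := 4 * (B₁ * (4 / (3 * s)) ^ (a + 1) * (Real.exp (-(η / 2 / n) * s) * ((5 / 4 : ℝ) * u)))
      + 2 * (B₀ * (2 / s) ^ a * Real.exp (-(η / 2 / n) * s)) / (((supNorm z / 4 : ℕ) : ℕ) : ℝ) with hαGdef
  have hαF0 : 0 ≤ αF := by positivity
  have hαG0 : 0 ≤ αG := by positivity
  clear_value θ0 θ1 θ2 κF κG Φ u Ψ αF αG s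
  have hΦu : Φ ≤ u := by
    rw [hΦ, hu]
    have he : Real.exp (-(η / 2 / n) * s) ≤ 1 := Real.exp_le_one_iff.mpr (by
      have : 0 ≤ η / 2 / n * s := by positivity
      linarith)
    have hs1 : 1 ≤ s ^ (a + 1) := one_le_pow₀ (by linarith)
    calc Real.exp (-(η / 2 / n) * s) * (1 + s / n) / s ^ (a + 1) ≤ Real.exp (-(η / 2 / n) * s) * (1 + s / n) / 1 :=
          div_le_div_of_nonneg_left (by positivity) one_pos hs1
      _ ≤ 1 * (1 + s / n) / 1 := by gcongr
      _ = 1 + s / n := by ring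
  have hΦ2 : Φ * Φ ≤ Ψ := by
    rw [hΦ, hΨ, hu]
    have he : Real.exp (-(η / 2 / n) * s) * Real.exp (-(η / 2 / n) * s) ≤ Real.exp (-(m / n) * s) := by
      rw [← Real.exp_add]
      refine Real.exp_le_exp.mpr ?_
      have : m / n * s ≤ η / n * s := mul_le_mul_of_nonneg_right (div_le_div_of_nonneg_right hmη hn'.le) hs0.le
      have e : -(η / 2 / (n : ℝ)) * s + -(η / 2 / n) * s = -(η / n * s) := by ring
      rw [e]; linarith
    have epow : s ^ (a + 1) * s ^ (a + 1) = s ^ (2 * a + 2) := by rw [← pow_add]; congr 1; ring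
    rw [div_mul_div_comm, epow]
    refine div_le_div_of_nonneg_right ?_ (by positivity)
    calc Real.exp (-(η / 2 / n) * s) * (1 + s / n) * (Real.exp (-(η / 2 / n) * s) * (1 + s / n))
        = (Real.exp (-(η / 2 / n) * s) * Real.exp (-(η / 2 / n) * s)) * (1 + s / n) ^ 2 := by ring
      _ ≤ Real.exp (-(m / n) * s) * (1 + s / n) ^ 2 := mul_le_mul_of_nonneg_right he (by positivity)
  have hBc : Real.exp (-(δ / 2) * ((s - 1) / 2)) ≤ Real.exp (δ / 4) * (((2 * a + 2).factorial : ℝ) * (8 / δ) ^ (2 * a + 2)) * (Ψ / u) := by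
    have h := termBc_le (a := 2 * a) (n := (n : ℝ)) (u := u) hδ hm hmδ (by exact_mod_cast hn) hs0 hu1
    have e : Real.exp (-(m / n) * s) * u / s ^ (2 * a + 2) = Ψ / u := by
      rw [hΨ]; field_simp
    rwa [e] at h
  have hmain : 16 * αF * αG * θ2 * θ0 ≤ 16 * κF * κG * θ2 * θ0 * Ψ := by
    have h1 : αF * αG ≤ (κF * Φ) * (κG * Φ) := mul_le_mul hαF hαG hαG0 (by positivity)
    calc 16 * αF * αG * θ2 * θ0 = 16 * θ2 * θ0 * (αF * αG) := by ring
      _ ≤ 16 * θ2 * θ0 * ((κF * Φ) * (κG * Φ)) := mul_le_mul_of_nonneg_left h1 (by positivity)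
      _ = 16 * κF * κG * θ2 * θ0 * (Φ * Φ) := by ring
      _ ≤ 16 * κF * κG * θ2 * θ0 * Ψ := mul_le_mul_of_nonneg_left hΦ2 (by positivity)
  have hcomp : Real.exp (-(δ / 2) * ((s - 1) / 2)) * (8 * (αF * Gg + αG * Fg) * θ1 * θ0 + 4 * Fg * Gg * θ0 ^ 2)
      ≤ Real.exp (δ / 4) * (((2 * a + 2).factorial : ℝ) * (8 / δ) ^ (2 * a + 2))
          * (8 * (κF * Gg + κG * Fg) * θ1 * θ0 + 4 * Fg * Gg * θ0 ^ 2) * Ψ := by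
    have hαFu : αF ≤ κF * u := hαF.trans (mul_le_mul_of_nonneg_left hΦu hκF0)
    have hαGu : αG ≤ κG * u := hαG.trans (mul_le_mul_of_nonneg_left hΦu hκG0)
    have h1 : 8 * (αF * Gg + αG * Fg) * θ1 * θ0 + 4 * Fg * Gg * θ0 ^ 2 ≤ (8 * (κF * Gg + κG * Fg) * θ1 * θ0 + 4 * Fg * Gg * θ0 ^ 2) * u := by
      have h2 : αF * Gg + αG * Fg ≤ (κF * Gg + κG * Fg) * u :=
        calc αF * Gg + αG * Fg ≤ κF * u * Gg + κG * u * Fg :=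
              add_le_add (mul_le_mul_of_nonneg_right hαFu hGg0) (mul_le_mul_of_nonneg_right hαGu hFg0)
          _ = (κF * Gg + κG * Fg) * u := by ring
      have h3 : 4 * Fg * Gg * θ0 ^ 2 ≤ 4 * Fg * Gg * θ0 ^ 2 * u := le_mul_of_one_le_right (by positivity) hu1
      calc 8 * (αF * Gg + αG * Fg) * θ1 * θ0 + 4 * Fg * Gg * θ0 ^ 2 = 8 * θ1 * θ0 * (αF * Gg + αG * Fg) + 4 * Fg * Gg * θ0 ^ 2 := by ring
        _ ≤ 8 * θ1 * θ0 * ((κF * Gg + κG * Fg) * u) + 4 * Fg * Gg * θ0 ^ 2 * u :=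
            add_le_add (mul_le_mul_of_nonneg_left h2 (by positivity)) h3
        _ = _ := by ring
    have hu0 : 0 < u := by linarith
    calc Real.exp (-(δ / 2) * ((s - 1) / 2)) * (8 * (αF * Gg + αG * Fg) * θ1 * θ0 + 4 * Fg * Gg * θ0 ^ 2)
        ≤ (Real.exp (δ / 4) * (((2 * a + 2).factorial : ℝ) * (8 / δ) ^ (2 * a + 2)) * (Ψ / u))
            * ((8 * (κF * Gg + κG * Fg) * θ1 * θ0 + 4 * Fg * Gg * θ0 ^ 2) * u) :=
          mul_le_mul hBc h1 (by positivity) (by positivity)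
      _ = _ := by field_simp
  calc CV * CW * (16 * αF * αG * θ2 * θ0 + Real.exp (-(δ / 2) * ((s - 1) / 2)) * (8 * (αF * Gg + αG * Fg) * θ1 * θ0 + 4 * Fg * Gg * θ0 ^ 2))
      ≤ CV * CW * (16 * κF * κG * θ2 * θ0 * Ψ + Real.exp (δ / 4) * (((2 * a + 2).factorial : ℝ) * (8 / δ) ^ (2 * a + 2))
          * (8 * (κF * Gg + κG * Fg) * θ1 * θ0 + 4 * Fg * Gg * θ0 ^ 2) * Ψ) :=
        mul_le_mul_of_nonneg_left (add_le_add hmain hcomp) (by positivity)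
    _ = _ := by rw [hΨ, hu]; ring

end GradedFar

/-! ## §3 The core `‖z‖∞ ≤ 8` and the uniform far shape of the bracket bubble beyond the window -/

section BubbleUniform

variable {V W : Pt × Pt → ℝ} {F G : Pt → ℝ} {CV CW δ Fg Gg A₀ A₁ B₀ B₁ η m : ℝ} {n a : ℕ}

/-- [folklore] THE TRIVIAL BOUND of the bracket family (any `z`): summable, and `|Σ'| ≤ CV·CW·(4FgGg)·Θ₀(δ)²`, `Θ₀(δ) := 2·e^{δ/2}·e^{δ/2}·Zl(δ/2)²`. -/
theorem abs_bracket_le_trivial (hδ : 0 < δ)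
    (hV : ∀ p : Pt × Pt, |V p| ≤ CV * (Real.exp (-δ * l1 p.1) * Real.exp (-δ * l1 p.2)))
    (hW : ∀ q : Pt × Pt, |W q| ≤ CW * (Real.exp (-δ * l1 q.1) * Real.exp (-δ * l1 q.2)))
    (hFg : ∀ t, |F t| ≤ Fg) (hGg : ∀ t, |G t| ≤ Gg) (z : Pt) :
    (Summable fun P : (Pt × Pt) × (Pt × Pt) =>
        V P.1 * W P.2 * ((F (z + (P.2.2 - P.1.1)) - F (z + (P.2.2 - P.1.2))) * (G (z + (P.2.1 - P.1.2)) - G (z + (P.2.2 - P.1.2)))))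
    ∧ |∑' P : (Pt × Pt) × (Pt × Pt),
        V P.1 * W P.2 * ((F (z + (P.2.2 - P.1.1)) - F (z + (P.2.2 - P.1.2))) * (G (z + (P.2.1 - P.1.2)) - G (z + (P.2.2 - P.1.2))))|
      ≤ CV * CW * (4 * Fg * Gg)
        * (2 ^ (0 + 1) * (((0 : ℕ).factorial : ℝ) * Real.exp (δ / 2) * (2 / δ) ^ 0) * Real.exp (δ / 2) * Zl 4 (δ / 2) ^ 2) ^ 2 := by
  have hCV : 0 ≤ CV := nonneg_of_loc hV
  have hCW : 0 ≤ CW := nonneg_of_loc hW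
  have hFg0 : 0 ≤ Fg := (abs_nonneg _).trans (hFg z)
  have hGg0 : 0 ≤ Gg := (abs_nonneg _).trans (hGg z)
  obtain ⟨hs0, hb0⟩ := tsum_prod_expWeight_pow_le (D := 4) hδ 0
  set ω : Pt × Pt → ℝ := fun p => Real.exp (-δ * l1 p.1) * Real.exp (-δ * l1 p.2) * ((l1 p.1 + 1) + (l1 p.2 + 1)) ^ 0 with hωdef
  have hωnn : 0 ≤ ω := fun p => by simp only [hωdef]; positivity
  set T : ℝ := ∑' p, ω p with hT
  have hT0 : 0 ≤ T := tsum_nonneg hωnn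
  have hTle : T ≤ _ := hb0
  have H : HasSum (fun P : (Pt × Pt) × (Pt × Pt) => ω P.1 * ω P.2) (T * T) := (hs0.hasSum.mul hs0.hasSum) (hs0.mul_of_nonneg hs0 hωnn hωnn)
  have HM := H.mul_left (CV * CW * (4 * Fg * Gg))
  clear_value T
  have hdom : ∀ P : (Pt × Pt) × (Pt × Pt),
      ‖V P.1 * W P.2 * ((F (z + (P.2.2 - P.1.1)) - F (z + (P.2.2 - P.1.2))) * (G (z + (P.2.1 - P.1.2)) - G (z + (P.2.2 - P.1.2))))‖
        ≤ CV * CW * (4 * Fg * Gg) * (ω P.1 * ω P.2) := by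
    rintro ⟨p, q⟩
    simp only [hωdef, pow_zero, mul_one]
    rw [Real.norm_eq_abs, abs_mul, abs_mul, abs_mul]
    have h1 : |F (z + (q.2 - p.1)) - F (z + (q.2 - p.2))| ≤ 2 * Fg := (abs_sub _ _).trans (by linarith [hFg (z + (q.2 - p.1)), hFg (z + (q.2 - p.2))])
    have h2 : |G (z + (q.1 - p.2)) - G (z + (q.2 - p.2))| ≤ 2 * Gg := (abs_sub _ _).trans (by linarith [hGg (z + (q.1 - p.2)), hGg (z + (q.2 - p.2))])
    calc |V p| * |W q| * (|F (z + (q.2 - p.1)) - F (z + (q.2 - p.2))| * |G (z + (q.1 - p.2)) - G (z + (q.2 - p.2))|)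
        ≤ (CV * (Real.exp (-δ * l1 p.1) * Real.exp (-δ * l1 p.2))) * (CW * (Real.exp (-δ * l1 q.1) * Real.exp (-δ * l1 q.2))) * ((2 * Fg) * (2 * Gg)) :=
          mul_le_mul (mul_le_mul (hV p) (hW q) (abs_nonneg _) (by positivity)) (mul_le_mul h1 h2 (abs_nonneg _) (by positivity))
            (by positivity) (by positivity)
      _ = _ := by ring
  refine ⟨Summable.of_norm_bounded HM.summable hdom, ?_⟩
  have hb := tsum_of_norm_bounded HM hdom
  rw [Real.norm_eq_abs] at hb
  refine hb.trans ?_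
  rw [pow_two]
  exact mul_le_mul_of_nonneg_left (mul_le_mul hTle hTle hT0 (hT0.trans hTle)) (by positivity)

/-- [folklore] **THE UNIFORM FAR SHAPE OF THE BRACKET BUBBLE BEYOND THE WINDOW**: under the hypotheses of `abs_bracket_le_of_graded_far`, for EVERY `z` with
`‖z‖∞ > n` (`n ≥ 1`): `|Σ' bracket| ≤ (Kb + Kc)/‖z‖∞^{2a+2}·(e^{−(m/n)‖z‖∞}(1+‖z‖∞/n)²)` with `Kb` the constant of `abs_bracket_le_of_graded_far` and
`Kc := CV·CW·4FgGg·Θ₀(δ)²·8^{2a+2}·e^{8m}` (the core `‖z‖∞ ≤ 8`) — LITERALLY the `hfar` of `FarRegionMoment.shellBound_of_farShape ∕ sum_far_abs_le ∕ summable_moment`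
with `(C, δ, b) := (Kb + Kc, m, 2)` at `a = 2` (exponent `2·2+2 = 6`). -/
theorem abs_bracket_le_of_graded (hδ : 0 < δ)
    (hV : ∀ p : Pt × Pt, |V p| ≤ CV * (Real.exp (-δ * l1 p.1) * Real.exp (-δ * l1 p.2)))
    (hW : ∀ q : Pt × Pt, |W q| ≤ CW * (Real.exp (-δ * l1 q.1) * Real.exp (-δ * l1 q.2)))
    (hFg : ∀ t, |F t| ≤ Fg) (hGg : ∀ t, |G t| ≤ Gg) (hn : 1 ≤ n) (hη : 0 < η)
    (hA0 : 0 ≤ A₀) (hA1 : 0 ≤ A₁) (hB0 : 0 ≤ B₀) (hB1 : 0 ≤ B₁)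
    (hF0g : ∀ t : Pt, 0 < supNorm t → |F t| ≤ A₀ / (supNorm t : ℝ) ^ a * Real.exp (-(η / n) * supNorm t))
    (hF1g : ∀ t : Pt, 0 < supNorm t → ∀ i, |Δ_[(Pi.single i 1 : Pt)] F t|
      ≤ A₁ / (supNorm t : ℝ) ^ (a + 1) * (Real.exp (-(η / n) * supNorm t) * (1 + (supNorm t : ℝ) / n)))
    (hG0g : ∀ t : Pt, 0 < supNorm t → |G t| ≤ B₀ / (supNorm t : ℝ) ^ a * Real.exp (-(η / n) * supNorm t))
    (hG1g : ∀ t : Pt, 0 < supNorm t → ∀ i, |Δ_[(Pi.single i 1 : Pt)] G t|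
      ≤ B₁ / (supNorm t : ℝ) ^ (a + 1) * (Real.exp (-(η / n) * supNorm t) * (1 + (supNorm t : ℝ) / n)))
    (hm : 0 < m) (hmη : m ≤ η) (hmδ : m ≤ δ / 8) :
    ∀ z : Pt, n < supNorm z →
      |∑' P : (Pt × Pt) × (Pt × Pt),
          V P.1 * W P.2 * ((F (z + (P.2.2 - P.1.1)) - F (z + (P.2.2 - P.1.2))) * (G (z + (P.2.1 - P.1.2)) - G (z + (P.2.2 - P.1.2))))|
        ≤ (CV * CW * (16 * (4 * A₁ * (4 / 3 : ℝ) ^ (a + 1) * (5 / 4) + 16 * 2 ^ a * A₀) * (4 * B₁ * (4 / 3 : ℝ) ^ (a + 1) * (5 / 4) + 16 * 2 ^ a * B₀)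
              * (2 ^ (2 + 1) * (((2 : ℕ).factorial : ℝ) * Real.exp (δ / 2 / 2) * (2 / (δ / 2)) ^ 2) * Real.exp (δ / 2 / 2) * Zl 4 (δ / 2 / 2) ^ 2)
              * (2 ^ (0 + 1) * (((0 : ℕ).factorial : ℝ) * Real.exp (δ / 2 / 2) * (2 / (δ / 2)) ^ 0) * Real.exp (δ / 2 / 2) * Zl 4 (δ / 2 / 2) ^ 2)
            + Real.exp (δ / 4) * (((2 * a + 2).factorial : ℝ) * (8 / δ) ^ (2 * a + 2))
              * (8 * ((4 * A₁ * (4 / 3 : ℝ) ^ (a + 1) * (5 / 4) + 16 * 2 ^ a * A₀) * Gg + (4 * B₁ * (4 / 3 : ℝ) ^ (a + 1) * (5 / 4) + 16 * 2 ^ a * B₀) * Fg)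
                  * (2 ^ (1 + 1) * (((1 : ℕ).factorial : ℝ) * Real.exp (δ / 2 / 2) * (2 / (δ / 2)) ^ 1) * Real.exp (δ / 2 / 2) * Zl 4 (δ / 2 / 2) ^ 2)
                  * (2 ^ (0 + 1) * (((0 : ℕ).factorial : ℝ) * Real.exp (δ / 2 / 2) * (2 / (δ / 2)) ^ 0) * Real.exp (δ / 2 / 2) * Zl 4 (δ / 2 / 2) ^ 2)
                + 4 * Fg * Gg
                  * (2 ^ (0 + 1) * (((0 : ℕ).factorial : ℝ) * Real.exp (δ / 2 / 2) * (2 / (δ / 2)) ^ 0) * Real.exp (δ / 2 / 2) * Zl 4 (δ / 2 / 2) ^ 2) ^ 2))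
            + CV * CW * (4 * Fg * Gg)
              * (2 ^ (0 + 1) * (((0 : ℕ).factorial : ℝ) * Real.exp (δ / 2) * (2 / δ) ^ 0) * Real.exp (δ / 2) * Zl 4 (δ / 2) ^ 2) ^ 2
              * ((8 : ℝ) ^ (2 * a + 2) * Real.exp (8 * m)))
          / (supNorm z : ℝ) ^ (2 * a + 2) * (Real.exp (-(m / n) * supNorm z) * (1 + (supNorm z : ℝ) / n) ^ 2) := by
  intro z hz
  have hCV : 0 ≤ CV := nonneg_of_loc hV
  have hCW : 0 ≤ CW := nonneg_of_loc hW
  have hFg0 : 0 ≤ Fg := (abs_nonneg _).trans (hFg z)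
  have hGg0 : 0 ≤ Gg := (abs_nonneg _).trans (hGg z)
  have hZ : 0 < Zl 4 (δ / 2 / 2) := Zl_pos (by positivity)
  have hZ' : 0 < Zl 4 (δ / 2) := Zl_pos (by positivity)
  have hn' : (1 : ℝ) ≤ n := by exact_mod_cast hn
  have hs0 : (0 : ℝ) < supNorm z := by exact_mod_cast (show 0 < supNorm z by omega)
  set Kb : ℝ := CV * CW * (16 * (4 * A₁ * (4 / 3 : ℝ) ^ (a + 1) * (5 / 4) + 16 * 2 ^ a * A₀) * (4 * B₁ * (4 / 3 : ℝ) ^ (a + 1) * (5 / 4) + 16 * 2 ^ a * B₀)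
              * (2 ^ (2 + 1) * (((2 : ℕ).factorial : ℝ) * Real.exp (δ / 2 / 2) * (2 / (δ / 2)) ^ 2) * Real.exp (δ / 2 / 2) * Zl 4 (δ / 2 / 2) ^ 2)
              * (2 ^ (0 + 1) * (((0 : ℕ).factorial : ℝ) * Real.exp (δ / 2 / 2) * (2 / (δ / 2)) ^ 0) * Real.exp (δ / 2 / 2) * Zl 4 (δ / 2 / 2) ^ 2)
            + Real.exp (δ / 4) * (((2 * a + 2).factorial : ℝ) * (8 / δ) ^ (2 * a + 2))
              * (8 * ((4 * A₁ * (4 / 3 : ℝ) ^ (a + 1) * (5 / 4) + 16 * 2 ^ a * A₀) * Gg + (4 * B₁ * (4 / 3 : ℝ) ^ (a + 1) * (5 / 4) + 16 * 2 ^ a * B₀) * Fg)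
                  * (2 ^ (1 + 1) * (((1 : ℕ).factorial : ℝ) * Real.exp (δ / 2 / 2) * (2 / (δ / 2)) ^ 1) * Real.exp (δ / 2 / 2) * Zl 4 (δ / 2 / 2) ^ 2)
                  * (2 ^ (0 + 1) * (((0 : ℕ).factorial : ℝ) * Real.exp (δ / 2 / 2) * (2 / (δ / 2)) ^ 0) * Real.exp (δ / 2 / 2) * Zl 4 (δ / 2 / 2) ^ 2)
                + 4 * Fg * Gg
                  * (2 ^ (0 + 1) * (((0 : ℕ).factorial : ℝ) * Real.exp (δ / 2 / 2) * (2 / (δ / 2)) ^ 0) * Real.exp (δ / 2 / 2) * Zl 4 (δ / 2 / 2) ^ 2) ^ 2)) with hKb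
  set Kc : ℝ := CV * CW * (4 * Fg * Gg)
              * (2 ^ (0 + 1) * (((0 : ℕ).factorial : ℝ) * Real.exp (δ / 2) * (2 / δ) ^ 0) * Real.exp (δ / 2) * Zl 4 (δ / 2) ^ 2) ^ 2
              * ((8 : ℝ) ^ (2 * a + 2) * Real.exp (8 * m)) with hKc
  set Ψ : ℝ := Real.exp (-(m / n) * supNorm z) * (1 + (supNorm z : ℝ) / n) ^ 2 / (supNorm z : ℝ) ^ (2 * a + 2) with hΨ
  have hKb0 : 0 ≤ Kb := by positivity
  have hKc0 : 0 ≤ Kc := by positivity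
  have hΨ0 : 0 ≤ Ψ := by positivity
  have e : (Kb + Kc) / (supNorm z : ℝ) ^ (2 * a + 2) * (Real.exp (-(m / n) * supNorm z) * (1 + (supNorm z : ℝ) / n) ^ 2) = (Kb + Kc) * Ψ := by
    rw [hΨ]; ring
  rw [e]
  by_cases h8 : 8 ≤ supNorm z
  · have h := abs_bracket_le_of_graded_far hδ hV hW hFg hGg hn hη hA0 hA1 hB0 hB1 hF0g hF1g hG0g hG1g hm hmη hmδ h8
    calc _ ≤ Kb * Ψ := h
      _ ≤ (Kb + Kc) * Ψ := mul_le_mul_of_nonneg_right (le_add_of_nonneg_right hKc0) hΨ0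
  · -- the core: trivial bound, then the shape factor is bounded below
    obtain ⟨-, h⟩ := abs_bracket_le_trivial hδ hV hW hFg hGg z
    have hs8 : (supNorm z : ℝ) ≤ 8 := by exact_mod_cast (show supNorm z ≤ 8 by omega)
    have hlow : 1 ≤ ((8 : ℝ) ^ (2 * a + 2) * Real.exp (8 * m)) * Ψ := by
      rw [hΨ]
      have h1 : (supNorm z : ℝ) ^ (2 * a + 2) ≤ (8 : ℝ) ^ (2 * a + 2) := pow_le_pow_left₀ hs0.le hs8 _
      have h2 : 1 ≤ Real.exp (8 * m) * Real.exp (-(m / n) * supNorm z) := by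
        rw [← Real.exp_add]
        refine Real.one_le_exp_iff.mpr ?_ |>.trans' le_rfl
        have hmn : m / n ≤ m := div_le_self hm.le hn'
        have : m / n * (supNorm z : ℝ) ≤ m * 8 := mul_le_mul hmn hs8 hs0.le hm.le
        linarith
      have h3 : (1 : ℝ) ≤ (1 + (supNorm z : ℝ) / n) ^ 2 := one_le_pow₀ (by linarith [div_nonneg hs0.le (zero_le_one.trans hn')])
      have hs02 : 0 < (supNorm z : ℝ) ^ (2 * a + 2) := by positivity
      have h4 : (1 : ℝ) ≤ (8 : ℝ) ^ (2 * a + 2) / (supNorm z : ℝ) ^ (2 * a + 2) := by rw [le_div_iff₀ hs02, one_mul]; exact h1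
      rw [show ((8 : ℝ) ^ (2 * a + 2) * Real.exp (8 * m))
            * (Real.exp (-(m / n) * supNorm z) * (1 + (supNorm z : ℝ) / n) ^ 2 / (supNorm z : ℝ) ^ (2 * a + 2))
          = ((8 : ℝ) ^ (2 * a + 2) / (supNorm z : ℝ) ^ (2 * a + 2))
            * ((Real.exp (8 * m) * Real.exp (-(m / n) * supNorm z)) * (1 + (supNorm z : ℝ) / n) ^ 2) by field_simp]
      calc (1 : ℝ) = 1 * (1 * 1) := by ring
        _ ≤ ((8 : ℝ) ^ (2 * a + 2) / (supNorm z : ℝ) ^ (2 * a + 2)) * ((Real.exp (8 * m) * Real.exp (-(m / n) * supNorm z)) * (1 + (supNorm z : ℝ) / n) ^ 2) :=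
            mul_le_mul h4 (mul_le_mul h2 h3 zero_le_one (by positivity)) (by positivity) (by positivity)
    have hcore : |∑' P : (Pt × Pt) × (Pt × Pt),
        V P.1 * W P.2 * ((F (z + (P.2.2 - P.1.1)) - F (z + (P.2.2 - P.1.2))) * (G (z + (P.2.1 - P.1.2)) - G (z + (P.2.2 - P.1.2))))| ≤ Kc * Ψ := by
      refine h.trans ?_
      rw [hKc]
      calc CV * CW * (4 * Fg * Gg) * (2 ^ (0 + 1) * (((0 : ℕ).factorial : ℝ) * Real.exp (δ / 2) * (2 / δ) ^ 0) * Real.exp (δ / 2) * Zl 4 (δ / 2) ^ 2) ^ 2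
          = CV * CW * (4 * Fg * Gg) * (2 ^ (0 + 1) * (((0 : ℕ).factorial : ℝ) * Real.exp (δ / 2) * (2 / δ) ^ 0) * Real.exp (δ / 2) * Zl 4 (δ / 2) ^ 2) ^ 2 * 1 := (mul_one _).symm
        _ ≤ CV * CW * (4 * Fg * Gg) * (2 ^ (0 + 1) * (((0 : ℕ).factorial : ℝ) * Real.exp (δ / 2) * (2 / δ) ^ 0) * Real.exp (δ / 2) * Zl 4 (δ / 2) ^ 2) ^ 2
              * (((8 : ℝ) ^ (2 * a + 2) * Real.exp (8 * m)) * Ψ) := mul_le_mul_of_nonneg_left hlow (by positivity)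
        _ = _ := by ring
    calc _ ≤ Kc * Ψ := hcore
      _ ≤ (Kb + Kc) * Ψ := mul_le_mul_of_nonneg_right (le_add_of_nonneg_left hKb0) hΨ0

end BubbleUniform

end Summit.QuantumFields.BalabanUV.Beta.FP.FarRegionBubbleGraded

end
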